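import Summits.KontsevichZagierPeriods.Zeta5Search.Certificates.RayC5Forms
import Summits.KontsevichZagierPeriods.Zeta5Search.Certificates.BinomialSumBounds
import Summits.KontsevichZagierPeriods.Zeta5Search.Certificates.LogEnclosures
import Summits.KontsevichZagierPeriods.Zeta5Search.Certificates.LogEnclosuresRayC1
import Summits.KontsevichZagierPeriods.Zeta5Search.Certificates.LogEnclosuresRayC1B
import Summits.KontsevichZagierPeriods.Zeta5Search.Certificates.LogEnclosuresRayC1B2
import Summits.KontsevichZagierPeriods.Zeta5Search.Certificates.LogEnclosuresRayC1C
import Summits.KontsevichZagierPeriods.Zeta5Search.Certificates.LogEnclosuresRayC1D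
import Summits.KontsevichZagierPeriods.Zeta5Search.Certificates.LogEnclosuresRayC5
import Summits.KontsevichZagierPeriods.Zeta5Search.Certificates.LogEnclosuresRecord
import Summits.KontsevichZagierPeriods.Zeta5Search.Certificates.LogEnclosuresRecord2
import Summits.KontsevichZagierPeriods.Zeta5Search.Certificates.LogEnclosuresRecord3
import Summits.KontsevichZagierPeriods.Zeta5Search.Certificates.LogEnclosuresRecord3B
import Summits.KontsevichZagierPeriods.Zeta5Search.Certificates.LogEnclosuresRecord3C
import Summits.KontsevichZagierPeriods.Zeta5Search.Certificates.LogEnclosuresRecord4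
import Summits.KontsevichZagierPeriods.Zeta5Search.Certificates.LogEnclosuresSect12
import Summits.KontsevichZagierPeriods.Zeta5Search.Certificates.LogEnclosuresSect12B
import Summits.KontsevichZagierPeriods.Zeta5Search.Certificates.RecordRayGrowthUpper
import HarnessLib

/-!
# ζ(5) search — certificates: the growth of `Q(a·n)` on the ray RayC5, PROVED without a recurrence — I: lower bound
(cell `pub-zeta5`, P1 g11; port of certifier 2's `Certificates/RecordRayGrowth.lean`)

HONEST FRAMING: systematic search; no irrationality claim unless certified.

OUR work (Summit side). For the census T1-map ray `a·n`, `a = (11,19,14,18,17,23,26,18)` (`RayC5Forms`), the growth of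
`Q(a·n) = c5Q n` is bounded here from BELOW by tree theorems only (Stirling at a lattice point; certified logarithms):

* `abs_c5Q_ge` — for every `n ≥ 1`: `log|Q(a·n)| ≥ n·E − (7/2)·log(40n) − 14`, `E = growthEnt` = the entropy of the single
  lattice term `(k₁,k₂) = (33n, 32n)` of (17); `growthEnt_ge` : `E ≥ 109.9274` (true value `109.927487`; the real maximiser
  of the entropy is at `(k₁,k₂)/n ≈` the model point with value `109.9823` — the integer point costs `0.0548` nats).
The upper bound and the rates are in `Certificates/RayC5GrowthUpper.lean`. Method: CERTIFY-HOWTO §9 (certifier 2).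
-/

noncomputable section

open Finset Real Filter

namespace Summit.KontsevichZagierPeriods.Zeta5Search.RayC5

open Summit.KontsevichZagierPeriods.Zeta5Search.BinomialSum
open Summit.KontsevichZagierPeriods.Zeta5Search.LogEnclosures
open Literature.NumberTheory.Irrationality.BrownZudilin2022 (zchoose Qcoeff QOf pOf qOf)

/-! ### (17) on the ray -/

/-- The scaled parameter vector `p(a·n)`. -/
def pRayC5 (n : ℕ) : Fin 7 → ℤ := ![22 * n, 20 * n, 23 * n, 38 * n, 26 * n, 19 * n, 17 * n]

/-- The scaled parameter vector `q(a·n)`. -/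
def qRayC5 (n : ℕ) : Fin 5 → ℤ := ![18 * n, 17 * n, 14 * n, 11 * n, 19 * n]

/-- `p(a·n) = pRayC5 n`. -/
theorem pOf_aC5 (n : ℕ) : pOf (aC5 n) = pRayC5 n := by
  ext i; fin_cases i <;> simp [pOf, aC5, c5Vec, pRayC5] <;> ring

/-- `q(a·n) = qRayC5 n`. -/
theorem qOf_aC5 (n : ℕ) : qOf (aC5 n) = qRayC5 n := by
  ext i; fin_cases i <;> simp [qOf, aC5, c5Vec, qRayC5] <;> ring

/-- `Q(a·n) = Q(pRayC5 n; qRayC5 n)`. -/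
theorem c5Q_eq_Qcoeff (n : ℕ) : c5Q n = Qcoeff (pRayC5 n) (qRayC5 n) := by
  unfold c5Q QOf; rw [pOf_aC5, qOf_aC5]

/-- `p(a·n)_0 = 22n`. -/
@[simp] theorem pRayC5_0 (n : ℕ) : pRayC5 n 0 = 22 * n := rfl
/-- `p(a·n)_1 = 20n`. -/
@[simp] theorem pRayC5_1 (n : ℕ) : pRayC5 n 1 = 20 * n := rfl
/-- `p(a·n)_2 = 23n`. -/
@[simp] theorem pRayC5_2 (n : ℕ) : pRayC5 n 2 = 23 * n := rfl
/-- `p(a·n)_3 = 38n`. -/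
@[simp] theorem pRayC5_3 (n : ℕ) : pRayC5 n 3 = 38 * n := rfl
/-- `p(a·n)_4 = 26n`. -/
@[simp] theorem pRayC5_4 (n : ℕ) : pRayC5 n 4 = 26 * n := rfl
/-- `p(a·n)_5 = 19n`. -/
@[simp] theorem pRayC5_5 (n : ℕ) : pRayC5 n 5 = 19 * n := rfl
/-- `p(a·n)_6 = 17n`. -/
@[simp] theorem pRayC5_6 (n : ℕ) : pRayC5 n 6 = 17 * n := rfl
/-- `q(a·n)_0 = 18n`. -/
@[simp] theorem qRayC5_0 (n : ℕ) : qRayC5 n 0 = 18 * n := rfl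
/-- `q(a·n)_1 = 17n`. -/
@[simp] theorem qRayC5_1 (n : ℕ) : qRayC5 n 1 = 17 * n := rfl
/-- `q(a·n)_2 = 14n`. -/
@[simp] theorem qRayC5_2 (n : ℕ) : qRayC5 n 2 = 14 * n := rfl
/-- `q(a·n)_3 = 11n`. -/
@[simp] theorem qRayC5_3 (n : ℕ) : qRayC5 n 3 = 11 * n := rfl
/-- `q(a·n)_4 = 19n`. -/
@[simp] theorem qRayC5_4 (n : ℕ) : qRayC5 n 4 = 19 * n := rfl

/-! ### Lower bound: the lattice term `(33n, 32n)` -/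

/-- The `(33n,32n)`-term of (17) on the ray as a product of seven natural binomials. -/
theorem latticeTerm_eq (n : ℕ) :
    qTerm (pRayC5 n) (qRayC5 n) (33 * n) (32 * n) =
      ((33 * n).choose (22 * n) : ℤ) * ((32 * n).choose (17 * n) : ℤ) * ((40 * n).choose (13 * n) : ℤ) * ((18 * n).choose (13 * n) : ℤ) * ((17 * n).choose (10 * n) : ℤ) * ((11 * n).choose (6 * n) : ℤ) * ((19 * n).choose (13 * n) : ℤ) := by
  unfold qTerm
  simp only [pRayC5_0, pRayC5_1, pRayC5_2, pRayC5_3, pRayC5_4, pRayC5_5, pRayC5_6, qRayC5_0, qRayC5_1, qRayC5_2, qRayC5_3, qRayC5_4]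
  rw [zchoose_cast_eq (n := 33 * n) (k := 22 * n) (by push_cast; ring) (by push_cast; ring) (by omega),
    zchoose_cast_eq (n := 32 * n) (k := 17 * n) (by push_cast; ring) (by push_cast; ring) (by omega),
    zchoose_cast_eq (n := 40 * n) (k := 13 * n) (by push_cast; ring) (by push_cast; ring) (by omega),
    zchoose_cast_eq (n := 18 * n) (k := 13 * n) (by push_cast; ring) (by push_cast; ring) (by omega),
    zchoose_cast_eq (n := 17 * n) (k := 10 * n) (by push_cast; ring) (by push_cast; ring) (by omega),
    zchoose_cast_eq (n := 11 * n) (k := 6 * n) (by push_cast; ring) (by push_cast; ring) (by omega),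
    zchoose_cast_eq (n := 19 * n) (k := 13 * n) (by push_cast; ring) (by push_cast; ring) (by omega)]

/-- The entropy of the lattice term per step `n` (`= 109.92748679…`). -/
def growthEnt : ℝ :=
  (33 * Real.log 33 - 22 * Real.log 22 - (33 - 22) * Real.log (33 - 22))
  + (32 * Real.log 32 - 17 * Real.log 17 - (32 - 17) * Real.log (32 - 17))
  + (40 * Real.log 40 - 13 * Real.log 13 - (40 - 13) * Real.log (40 - 13))
  + (18 * Real.log 18 - 13 * Real.log 13 - (18 - 13) * Real.log (18 - 13))
  + (17 * Real.log 17 - 10 * Real.log 10 - (17 - 10) * Real.log (17 - 10))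
  + (11 * Real.log 11 - 6 * Real.log 6 - (11 - 6) * Real.log (11 - 6))
  + (19 * Real.log 19 - 13 * Real.log 13 - (19 - 13) * Real.log (19 - 13))

/-- **`E ≥ 109.9274`** (certified logarithms). -/
theorem growthEnt_ge : (549637 / 5000 : ℝ) ≤ growthEnt := by
  unfold growthEnt
  norm_num only
  obtain ⟨lo0, hi0⟩ := log_33_bounds
  obtain ⟨lo1, hi1⟩ := log_22_bounds
  obtain ⟨lo2, hi2⟩ := log_11_bounds
  obtain ⟨lo3, hi3⟩ := log_32_bounds
  obtain ⟨lo4, hi4⟩ := log_17_bounds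
  obtain ⟨lo5, hi5⟩ := log_15_bounds
  obtain ⟨lo6, hi6⟩ := log_40_bounds
  obtain ⟨lo7, hi7⟩ := log_13_bounds
  obtain ⟨lo8, hi8⟩ := log_27_bounds
  obtain ⟨lo9, hi9⟩ := log_18_bounds
  obtain ⟨lo10, hi10⟩ := log_five_bounds
  obtain ⟨lo11, hi11⟩ := log_10_bounds
  obtain ⟨lo12, hi12⟩ := log_7_bounds
  obtain ⟨lo13, hi13⟩ := log_6_bounds
  obtain ⟨lo14, hi14⟩ := log_19_bounds
  linarith

/-- The lattice term is positive. -/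
theorem latticeTerm_pos (n : ℕ) : (0 : ℝ) < (qTerm (pRayC5 n) (qRayC5 n) (33 * n) (32 * n) : ℝ) := by
  rw [latticeTerm_eq]; push_cast
  have c1 : (0 : ℝ) < ((33 * n).choose (22 * n) : ℝ) := by exact_mod_cast Nat.choose_pos (by omega)
  have c2 : (0 : ℝ) < ((32 * n).choose (17 * n) : ℝ) := by exact_mod_cast Nat.choose_pos (by omega)
  have c3 : (0 : ℝ) < ((40 * n).choose (13 * n) : ℝ) := by exact_mod_cast Nat.choose_pos (by omega)
  have c4 : (0 : ℝ) < ((18 * n).choose (13 * n) : ℝ) := by exact_mod_cast Nat.choose_pos (by omega)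
  have c5 : (0 : ℝ) < ((17 * n).choose (10 * n) : ℝ) := by exact_mod_cast Nat.choose_pos (by omega)
  have c6 : (0 : ℝ) < ((11 * n).choose (6 * n) : ℝ) := by exact_mod_cast Nat.choose_pos (by omega)
  have c7 : (0 : ℝ) < ((19 * n).choose (13 * n) : ℝ) := by exact_mod_cast Nat.choose_pos (by omega)
  exact mul_pos (mul_pos (mul_pos (mul_pos (mul_pos (mul_pos c1 c2) c3) c4) c5) c6) c7

/-- The lattice point lies in the box of (17). -/
theorem lattice_mem (n : ℕ) : (33 * n : ℤ) ∈ Icc (pRayC5 n 1) (pRayC5 n 1 + qRayC5 n 0) ∧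
    (32 * n : ℤ) ∈ Icc (pRayC5 n 4) (pRayC5 n 4 + qRayC5 n 3) := by
  rw [mem_Icc, mem_Icc, pRayC5_1, qRayC5_0, pRayC5_4, qRayC5_3]
  refine ⟨⟨by linarith, by linarith⟩, ⟨by linarith, by linarith⟩⟩

/-- The lattice term bounds `|Q(a·n)|` from below, and hence `|Q(a·n)| > 0`, for every `n`. -/
theorem latticeTerm_le_abs_c5Q (n : ℕ) :
    (qTerm (pRayC5 n) (qRayC5 n) (33 * n) (32 * n) : ℝ) ≤ |(c5Q n : ℝ)| ∧ (0 : ℝ) < |(c5Q n : ℝ)| := by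
  obtain ⟨hk₁, hk₂⟩ := lattice_mem n
  have hle := qTerm_le_abs_Qcoeff (pRayC5 n) (qRayC5 n) hk₁ hk₂
  rw [← c5Q_eq_Qcoeff] at hle
  exact ⟨hle, (latticeTerm_pos n).trans_le hle⟩

/-- The sum of the seven Stirling lower bounds at the lattice point, per factor. -/
def latticeStirling (n : ℕ) : ℝ :=
  ((n : ℝ) * (33 * Real.log 33 - 22 * Real.log 22 - (33 - 22) * Real.log (33 - 22)) - Real.log (33 * n) / 2 - 2)
  + ((n : ℝ) * (32 * Real.log 32 - 17 * Real.log 17 - (32 - 17) * Real.log (32 - 17)) - Real.log (32 * n) / 2 - 2)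
  + ((n : ℝ) * (40 * Real.log 40 - 13 * Real.log 13 - (40 - 13) * Real.log (40 - 13)) - Real.log (40 * n) / 2 - 2)
  + ((n : ℝ) * (18 * Real.log 18 - 13 * Real.log 13 - (18 - 13) * Real.log (18 - 13)) - Real.log (18 * n) / 2 - 2)
  + ((n : ℝ) * (17 * Real.log 17 - 10 * Real.log 10 - (17 - 10) * Real.log (17 - 10)) - Real.log (17 * n) / 2 - 2)
  + ((n : ℝ) * (11 * Real.log 11 - 6 * Real.log 6 - (11 - 6) * Real.log (11 - 6)) - Real.log (11 * n) / 2 - 2)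
  + ((n : ℝ) * (19 * Real.log 19 - 13 * Real.log 13 - (19 - 13) * Real.log (19 - 13)) - Real.log (19 * n) / 2 - 2)

/-- Replacing every `log(αᵢ n)` by `log(40 n)`: `n·E − (7/2)·log(40n) − 14 ≤ latticeStirling n`. -/
theorem latticeStirling_ge {n : ℕ} (hn : 1 ≤ n) :
    (n : ℝ) * growthEnt - 7 / 2 * Real.log (40 * n) - 14 ≤ latticeStirling n := by
  have hn' : (1 : ℝ) ≤ n := by exact_mod_cast hn
  have m1 : Real.log (33 * n) ≤ Real.log (40 * n) := Real.log_le_log (by positivity) (by linarith)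
  have m2 : Real.log (32 * n) ≤ Real.log (40 * n) := Real.log_le_log (by positivity) (by linarith)
  have m4 : Real.log (18 * n) ≤ Real.log (40 * n) := Real.log_le_log (by positivity) (by linarith)
  have m5 : Real.log (17 * n) ≤ Real.log (40 * n) := Real.log_le_log (by positivity) (by linarith)
  have m6 : Real.log (11 * n) ≤ Real.log (40 * n) := Real.log_le_log (by positivity) (by linarith)
  have m7 : Real.log (19 * n) ≤ Real.log (40 * n) := Real.log_le_log (by positivity) (by linarith)
  have hE : latticeStirling n = (n : ℝ) * growthEnt - (Real.log (33 * n) + Real.log (32 * n) + Real.log (40 * n) + Real.log (18 * n) + Real.log (17 * n) + Real.log (11 * n) + Real.log (19 * n)) / 2 - 14 := by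
    unfold latticeStirling growthEnt; ring
  rw [hE]
  linarith

/-- Stirling for the seven factors: `exp(latticeStirling n) ≤` the lattice term. -/
theorem exp_le_latticeTerm {n : ℕ} (hn : 1 ≤ n) :
    Real.exp (latticeStirling n) ≤ (qTerm (pRayC5 n) (qRayC5 n) (33 * n) (32 * n) : ℝ) := by
  rw [latticeTerm_eq]; push_cast
  have s1 := log_choose_ge_scaled (α := 33) (β := 22) (by norm_num) (by norm_num) hn
  have s2 := log_choose_ge_scaled (α := 32) (β := 17) (by norm_num) (by norm_num) hn
  have s3 := log_choose_ge_scaled (α := 40) (β := 13) (by norm_num) (by norm_num) hn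
  have s4 := log_choose_ge_scaled (α := 18) (β := 13) (by norm_num) (by norm_num) hn
  have s5 := log_choose_ge_scaled (α := 17) (β := 10) (by norm_num) (by norm_num) hn
  have s6 := log_choose_ge_scaled (α := 11) (β := 6) (by norm_num) (by norm_num) hn
  have s7 := log_choose_ge_scaled (α := 19) (β := 13) (by norm_num) (by norm_num) hn
  push_cast at s1 s2 s3 s4 s5 s6 s7
  have c1 : (0 : ℝ) < ((33 * n).choose (22 * n) : ℝ) := by exact_mod_cast Nat.choose_pos (by omega)
  have c2 : (0 : ℝ) < ((32 * n).choose (17 * n) : ℝ) := by exact_mod_cast Nat.choose_pos (by omega)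
  have c3 : (0 : ℝ) < ((40 * n).choose (13 * n) : ℝ) := by exact_mod_cast Nat.choose_pos (by omega)
  have c4 : (0 : ℝ) < ((18 * n).choose (13 * n) : ℝ) := by exact_mod_cast Nat.choose_pos (by omega)
  have c5 : (0 : ℝ) < ((17 * n).choose (10 * n) : ℝ) := by exact_mod_cast Nat.choose_pos (by omega)
  have c6 : (0 : ℝ) < ((11 * n).choose (6 * n) : ℝ) := by exact_mod_cast Nat.choose_pos (by omega)
  have c7 : (0 : ℝ) < ((19 * n).choose (13 * n) : ℝ) := by exact_mod_cast Nat.choose_pos (by omega)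
  have hprod := prod7_le (Real.exp_nonneg _) (Real.exp_nonneg _) (Real.exp_nonneg _) (Real.exp_nonneg _)
    (Real.exp_nonneg _) (Real.exp_nonneg _) (Real.exp_nonneg _)
    ((Real.le_log_iff_exp_le c1).1 s1) ((Real.le_log_iff_exp_le c2).1 s2) ((Real.le_log_iff_exp_le c3).1 s3)
    ((Real.le_log_iff_exp_le c4).1 s4) ((Real.le_log_iff_exp_le c5).1 s5) ((Real.le_log_iff_exp_le c6).1 s6)
    ((Real.le_log_iff_exp_le c7).1 s7)
  refine le_trans (le_of_eq ?_) hprod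
  simp only [← Real.exp_add]
  rfl

/-- **Lower bound for every `n ≥ 1`**: `n·E − (7/2)·log(40n) − 14 ≤ log|Q(a·n)|`. -/
theorem abs_c5Q_ge {n : ℕ} (hn : 1 ≤ n) :
    (n : ℝ) * growthEnt - 7 / 2 * Real.log (40 * n) - 14 ≤ Real.log |(c5Q n : ℝ)| := by
  obtain ⟨hk₁, hk₂⟩ := lattice_mem n
  have hle := qTerm_le_abs_Qcoeff (pRayC5 n) (qRayC5 n) hk₁ hk₂
  rw [← c5Q_eq_Qcoeff] at hle
  have h := (Real.le_log_iff_exp_le (latticeTerm_le_abs_c5Q n).2).2 ((exp_le_latticeTerm hn).trans hle)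
  exact (latticeStirling_ge hn).trans h

end Summit.KontsevichZagierPeriods.Zeta5Search.RayC5
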